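import Literature.Analysis.Asymptotics.LaplaceMethodMultivariate
import Mathlib.MeasureTheory.Measure.Haar.Unique
import Mathlib.MeasureTheory.Measure.Haar.NormedSpace
import Mathlib.Analysis.InnerProductSpace.Adjoint
import HarnessLib

/-!
# The Jacobian of an orthogonal sum parametrisation `(φ, y) ↦ Tφ + Uy`: product Lebesgue measure
# versus Lebesgue measure, with the Gram (Faddeev–Popov) determinant as the exact constant

Topic `Analysis/InnerProduct`; namespace `Literature.Analysis.InnerProduct`.  Proof file: theorems only, no
definitions, no named facts.

THE RESULT.  Let `E, F, G` be finite-dimensional real inner product spaces (each with the Lebesgue measure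
`volume` normalised by its inner product), `T : E →ₗ G` and `U : F →ₗ G` injective linear maps with
ORTHOGONAL ranges spanning `G` (`⟪Tφ, Uy⟫ = 0`, `range T ⊔ range U = ⊤`), and `ι(φ, y) = Tφ + Uy` the
resulting linear parametrisation of `G` by `E × F`.  With the Gram determinants `det(T†T), det(U†U) > 0` and
`D = √det(T†T) · √det(U†U)`:

* ★ `map_prod_volume_eq_inv_smul_volume` — `ι_*(dφ ⊗ dy) = D⁻¹ · dw`  on `G`;
* ★ `volume_eq_smul_map_prod_volume` — `dw = D · ι_*(dφ ⊗ dy)`, and the substitution rules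
  `lintegral_volume_eq_mul_lintegral_prod` ∕ `integral_volume_eq_mul_integral_prod`
  (`∫_G g dw = D ∫_{E×F} g(Tφ + Uy) dφ dy`);
* ★ `volume_restrict_image_eq_map_withDensity` — the CHART-IDENTITY format of
  `MeasureTheory/Group/OrbitTubeMeasure.lean` ∕ `Analysis/Asymptotics/LaplaceMethodChart.lean`:
  `dw|_{ι(Ω)} = ι_*((dφ ⊗ dy)|_Ω · D)` for measurable `Ω ⊆ E × F`;
* the isometric case `U†U = 1` (`adjoint_comp_self_of_isometry`, `D = √det(T†T)`:
  `map_prod_volume_eq_inv_smul_volume_of_isometry`), e.g. `U` the inclusion of the submodule `(range T)ᗮ`.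

This is the linear instance of the area ∕ change-of-variables formula with the Jacobian
`⟦L⟧ = √det(L* ∘ L)` [EvansGariepy2015, §3.2 Def. 3.4 and Thm 3.6 (i) «⟦L⟧² = det(L* ∘ L)», §3.3.1 Lemma 3.1
«𝓗ⁿ(L(A)) = ⟦L⟧ 𝓛ⁿ(A)» (PDF pp. 72–74)]; for `L = ι` on the orthogonal sum, `ι*ι = T†T ⊕ U†U` and
`⟦ι⟧ = √det(T†T) · √det(U†U)` — the volume of the parallelepiped spanned by the columns is the square root
of the Gramian [Breitung1994, Lemma 3 (2.2) p. 10 (PDF p. 14)].  PROOF (no matrices): `ι` is a continuous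
linear equivalence `E × F ≃ G`, so `ι_*(dφ ⊗ dy)` is an additive Haar measure on `G`, hence `c · dw`
(uniqueness, Mathlib `isAddLeftInvariant_eq_smul`); the constant is read off ONE Gaussian:
`∫_G e^{−‖w‖²∕2} dw = (2π)^{dim G∕2}` while, by orthogonality and Fubini,
`∫ e^{−‖Tφ+Uy‖²∕2} dφ dy = (2π)^{dim E∕2} det(T†T)^{−1∕2} · (2π)^{dim F∕2} det(U†U)^{−1∕2}` (the tree's
`integral_exp_neg_half_inner_self'`), and `dim G = dim E + dim F`.

WHY (the use).  In tubular ∕ gauge-fixed coordinates around a critical gauge orbit the Lebesgue measure of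
the Lie algebra `𝔤_X` (in which the Haar density of the exponential chart is written) must be compared with
«Lebesgue(gauge parameters) ⊗ Lebesgue(transversal slice)», the measure the fibred Laplace method
integrates (`tendsto_laplaceMethod_fibred_chart`, `tendsto_laplaceMethod_orbit`); the linearisation of that
comparison is `ι(φ, y) = ∇φ + y` (infinitesimal gauge transformations ⊕ Coulomb slice `ker ∇†`), and the
constant `√det(∇†∇)` is the Faddeev–Popov determinant [Creutz2022, Ch. 9 «Gauge fixing» (PDF pp. 41–44)].

HONEST SCOPE.  Finite-dimensional linear algebra and measure theory; nothing about lattice gauge theory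
proper or the Yang–Mills mass gap (Clay), which is NOT proved; `R4` closes only the conditional
finite-`𝕋⁴` rung `BalabanLadder.UV`.

## Mathlib ∕ tree search
Mathlib: `Measure.addHaar_image_linearMap` ∕ `map_linearMap_addHaar_eq_smul_addHaar` (same space `E → E`,
constant `|det|`), `ContinuousLinearEquiv.isAddHaarMeasure_map`, `isAddLeftInvariant_eq_smul`,
`integral_prod_mul`, `LinearMap.adjoint` — used; no statement comparing the product Lebesgue measure of two
inner product spaces with the Lebesgue measure of a third through a linear isomorphism.  Tree:
`Analysis/Asymptotics/LaplaceMethodMultivariate.lean` (`integral_exp_neg_half_inner_self'`,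
`det_pos_of_inner_pos`) — imported.

## References
* L. C. Evans, R. F. Gariepy, *Measure Theory and Fine Properties of Functions*, revised ed., CRC (2015),
  §3.2 Def. 3.4, Thm 3.6; §3.3.1 Lemma 3.1 (PDF pp. 72–74). [EvansGariepy2015]
* K. W. Breitung, *Asymptotic Approximations for Probability Integrals*, LNM 1592 (1994), Lemma 3 (2.2)
  (PDF p. 14). [Breitung1994]
* M. Creutz, *Quarks, Gluons and Lattices*, CUP, Ch. 9 (PDF pp. 41–44). [Creutz2022]
-/

noncomputable section

open _root_.MeasureTheory _root_.MeasureTheory.Measure _root_.Set _root_.Module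
open scoped _root_.Real _root_.InnerProductSpace _root_.ENNReal _root_.NNReal

namespace Literature.Analysis.InnerProduct

open Literature.Analysis.Asymptotics

variable {E F G : Type*}
  [NormedAddCommGroup E] [InnerProductSpace ℝ E] [FiniteDimensional ℝ E]
  [NormedAddCommGroup F] [InnerProductSpace ℝ F] [FiniteDimensional ℝ F]
  [NormedAddCommGroup G] [InnerProductSpace ℝ G] [FiniteDimensional ℝ G]

/-! ## §1 Linear algebra of the orthogonal sum -/

section Algebra

variable {T : E →ₗ[ℝ] G} {U : F →ₗ[ℝ] G}

/-- The Gram form: `⟪(T†T) φ, φ⟫ = ‖Tφ‖²`. [cite: EvansGariepy2015, §3.2 Thm 3.6 (i) (PDF p. 72)] -/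
theorem inner_adjoint_comp_self_apply (T : E →ₗ[ℝ] G) (φ : E) :
    ⟪(LinearMap.adjoint T ∘ₗ T) φ, φ⟫_ℝ = ‖T φ‖ ^ 2 := by
  rw [LinearMap.comp_apply, LinearMap.adjoint_inner_left, real_inner_self_eq_norm_sq]

/-- `T†T` is symmetric. [cite: EvansGariepy2015, §3.2 Thm 3.6 (i) (PDF p. 72)] -/
theorem isSymmetric_adjoint_comp_self (T : E →ₗ[ℝ] G) : (LinearMap.adjoint T ∘ₗ T).IsSymmetric := by
  intro x y
  simp only [LinearMap.comp_apply, LinearMap.adjoint_inner_left, LinearMap.adjoint_inner_right]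

/-- `T†T` is positive definite when `T` is injective. [cite: EvansGariepy2015, §3.2 Thm 3.6 (i) (PDF p. 72)] -/
theorem inner_adjoint_comp_self_pos (hT : Function.Injective T) (φ : E) (hφ : φ ≠ 0) :
    0 < ⟪(LinearMap.adjoint T ∘ₗ T) φ, φ⟫_ℝ := by
  rw [inner_adjoint_comp_self_apply]
  have h : T φ ≠ 0 := fun h0 => hφ (hT (by rw [h0, map_zero]))
  positivity

/-- The Gram determinant `det(T†T)` of an injective map is positive.
[cite: EvansGariepy2015, §3.2 Thm 3.6 (i) and §3.3.1 Lemma 3.1 (PDF pp. 72–74)] -/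
theorem det_adjoint_comp_self_pos (hT : Function.Injective T) :
    0 < LinearMap.det (LinearMap.adjoint T ∘ₗ T) :=
  det_pos_of_inner_pos (isSymmetric_adjoint_comp_self T) (inner_adjoint_comp_self_pos hT)

/-- For an isometry `U`, `U†U = 1`. [cite: EvansGariepy2015, §3.2 Thm 3.4 (vi) (O* ∘ O = I for orthogonal O) (PDF p. 71)] -/
theorem adjoint_comp_self_of_isometry (U : F →ₗᵢ[ℝ] G) :
    LinearMap.adjoint U.toLinearMap ∘ₗ U.toLinearMap = LinearMap.id := by
  apply LinearMap.ext
  intro y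
  apply ext_inner_right ℝ
  intro y'
  rw [LinearMap.comp_apply, LinearMap.adjoint_inner_left, LinearMap.id_apply]
  exact U.inner_map_map y y'

omit [FiniteDimensional ℝ E] [FiniteDimensional ℝ F] [FiniteDimensional ℝ G] in
/-- **Pythagoras for the orthogonal sum**: `‖Tφ + Uy‖² = ‖Tφ‖² + ‖Uy‖²`.
[cite: EvansGariepy2015, §3.2 (PDF p. 73: «a higher dimensional generalization of the Pythagorean Theorem»)] -/
theorem norm_sq_add_eq_of_orthogonal (horth : ∀ φ y, ⟪T φ, U y⟫_ℝ = 0) (φ : E) (y : F) :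
    ‖T φ + U y‖ ^ 2 = ‖T φ‖ ^ 2 + ‖U y‖ ^ 2 := by
  rw [norm_add_sq_real, horth, mul_zero, add_zero]

omit [FiniteDimensional ℝ E] [FiniteDimensional ℝ F] [FiniteDimensional ℝ G] in
/-- **The orthogonal sum map is injective**: `Tφ + Uy = 0 ⟹ φ = 0 ∧ y = 0` for injective `T, U` with
orthogonal ranges. [cite: EvansGariepy2015, §3.3.1 Lemma 3.1 (PDF p. 74)] -/
theorem coprod_injective_of_orthogonal (hT : Function.Injective T) (hU : Function.Injective U)
    (horth : ∀ φ y, ⟪T φ, U y⟫_ℝ = 0) : Function.Injective (T.coprod U) := by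
  rw [← LinearMap.ker_eq_bot, LinearMap.ker_eq_bot']
  rintro ⟨φ, y⟩ h
  rw [LinearMap.coprod_apply] at h
  have h1 : ‖T φ‖ ^ 2 + ‖U y‖ ^ 2 = 0 := by
    rw [← norm_sq_add_eq_of_orthogonal horth, h, norm_zero, zero_pow two_ne_zero]
  have hT0 : T φ = 0 := by
    have : ‖T φ‖ ^ 2 = 0 := by nlinarith [sq_nonneg ‖T φ‖, sq_nonneg ‖U y‖]
    exact norm_eq_zero.1 (pow_eq_zero_iff two_ne_zero |>.1 this)
  have hU0 : U y = 0 := by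
    have : ‖U y‖ ^ 2 = 0 := by nlinarith [sq_nonneg ‖T φ‖, sq_nonneg ‖U y‖]
    exact norm_eq_zero.1 (pow_eq_zero_iff two_ne_zero |>.1 this)
  have hφ : φ = 0 := hT (by rw [hT0, map_zero])
  have hy : y = 0 := hU (by rw [hU0, map_zero])
  rw [hφ, hy]
  rfl

omit [FiniteDimensional ℝ E] [FiniteDimensional ℝ F] [FiniteDimensional ℝ G] in
/-- **The orthogonal sum map is bijective** when moreover the ranges span `G`.
[cite: EvansGariepy2015, §3.3.1 Lemma 3.1 (PDF p. 74)] -/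
theorem coprod_bijective_of_orthogonal (hT : Function.Injective T) (hU : Function.Injective U)
    (horth : ∀ φ y, ⟪T φ, U y⟫_ℝ = 0) (htop : LinearMap.range T ⊔ LinearMap.range U = ⊤) :
    Function.Bijective (T.coprod U) := by
  refine ⟨coprod_injective_of_orthogonal hT hU horth, ?_⟩
  rw [← LinearMap.range_eq_top, LinearMap.range_coprod, htop]

omit [FiniteDimensional ℝ G] in
/-- Dimension count: `dim G = dim E + dim F`. [cite: EvansGariepy2015, §3.3.1 Lemma 3.1 (PDF p. 74)] -/
theorem finrank_eq_add_of_orthogonal (hT : Function.Injective T) (hU : Function.Injective U)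
    (horth : ∀ φ y, ⟪T φ, U y⟫_ℝ = 0) (htop : LinearMap.range T ⊔ LinearMap.range U = ⊤) :
    finrank ℝ G = finrank ℝ E + finrank ℝ F := by
  rw [← (LinearEquiv.ofBijective (T.coprod U) (coprod_bijective_of_orthogonal hT hU horth htop)).finrank_eq,
    Module.finrank_prod]

end Algebra

/-! ## §2 The Jacobian: product Lebesgue measure versus Lebesgue measure -/

section Measure

variable [MeasurableSpace E] [BorelSpace E] [MeasurableSpace F] [BorelSpace F]
  [MeasurableSpace G] [BorelSpace G]
  {T : E →ₗ[ℝ] G} {U : F →ₗ[ℝ] G} {ι : E × F → G}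

/-- The standard Gaussian of an inner product space integrates to `(2π)^{dim∕2}`.
[cite: Breitung1994, Lemma 26 (2.102) p. 30] -/
theorem integral_exp_neg_half_norm_sq :
    ∫ w : G, Real.exp (-(1 / 2) * ‖w‖ ^ 2) = (2 * π) ^ ((finrank ℝ G : ℝ) / 2) := by
  have h := integral_exp_neg_half_inner_self' (V := G) (A := LinearMap.id) LinearMap.IsSymmetric.id
    (fun y hy => by rw [LinearMap.id_apply, real_inner_self_eq_norm_sq]; positivity)
  simp only [LinearMap.id_apply, real_inner_self_eq_norm_sq, LinearMap.det_id, Real.sqrt_one, div_one] at h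
  exact h

/-- ★ **The Jacobian of the orthogonal sum parametrisation.**  For injective `T : E →ₗ G`, `U : F →ₗ G` with
orthogonal ranges spanning `G` and `ι(φ, y) = Tφ + Uy`:
`ι_*(dφ ⊗ dy) = (√det(T†T) · √det(U†U))⁻¹ · dw`  (Lebesgue measures normalised by the inner products).
Proof: `ι_*(dφ ⊗ dy)` is an additive Haar measure, hence `c · dw`; `c` is read off the Gaussian
`e^{−‖w‖²∕2}`, which factorises over `E × F` by Pythagoras.
[cite: EvansGariepy2015, §3.2 Def. 3.4 ∕ Thm 3.6 (i) and §3.3.1 Lemma 3.1 (PDF pp. 72–74)]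
[cite: Breitung1994, Lemma 3 (2.2) (PDF p. 14)] -/
theorem map_prod_volume_eq_inv_smul_volume (hT : Function.Injective T) (hU : Function.Injective U)
    (horth : ∀ φ y, ⟪T φ, U y⟫_ℝ = 0) (htop : LinearMap.range T ⊔ LinearMap.range U = ⊤)
    (hι : ∀ z : E × F, ι z = T z.1 + U z.2) :
    ((volume : Measure E).prod (volume : Measure F)).map ι =
      (ENNReal.ofReal (Real.sqrt (LinearMap.det (LinearMap.adjoint T ∘ₗ T)) *
        Real.sqrt (LinearMap.det (LinearMap.adjoint U ∘ₗ U))))⁻¹ • (volume : Measure G) := by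
  -- the continuous linear equivalence `ιC = ι`
  set ιE : (E × F) ≃ₗ[ℝ] G :=
    LinearEquiv.ofBijective (T.coprod U) (coprod_bijective_of_orthogonal hT hU horth htop) with hιE
  set ιC : (E × F) ≃L[ℝ] G := ιE.toContinuousLinearEquiv with hιC
  have hιCapply : ∀ z : E × F, ιC z = ι z := fun z => by
    rw [hι z]
    simp [hιC, hιE, LinearMap.coprod_apply]
  have hιfun : ι = ⇑ιC := funext fun z => (hιCapply z).symm
  -- `ι_*(dφ ⊗ dy)` is an additive Haar measure, hence a multiple of Lebesgue measure
  set μ₀ : Measure (E × F) := (volume : Measure E).prod (volume : Measure F) with hμ₀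
  haveI : (μ₀.map ιC).IsAddHaarMeasure := ιC.isAddHaarMeasure_map μ₀
  set c : ℝ≥0 := addHaarScalarFactor (μ₀.map ιC) volume with hc
  have hm : μ₀.map ιC = c • (volume : Measure G) := isAddLeftInvariant_eq_smul (μ₀.map ιC) volume
  -- the Gram data
  set dT : ℝ := LinearMap.det (LinearMap.adjoint T ∘ₗ T) with hdT
  set dU : ℝ := LinearMap.det (LinearMap.adjoint U ∘ₗ U) with hdU
  have hdTpos : 0 < dT := det_adjoint_comp_self_pos hT
  have hdUpos : 0 < dU := det_adjoint_comp_self_pos hU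
  have hD : 0 < Real.sqrt dT * Real.sqrt dU := mul_pos (Real.sqrt_pos.2 hdTpos) (Real.sqrt_pos.2 hdUpos)
  -- evaluate the Gaussian `e^{−‖w‖²∕2}` against both sides
  set gauss : G → ℝ := fun w => Real.exp (-(1 / 2) * ‖w‖ ^ 2) with hgauss
  have hgc : Continuous gauss := by
    simp only [hgauss]
    fun_prop
  have hPE : (0 : ℝ) < (2 * π) ^ ((finrank ℝ E : ℝ) / 2) := by positivity
  have hPF : (0 : ℝ) < (2 * π) ^ ((finrank ℝ F : ℝ) / 2) := by positivity
  -- left side: through `ι`, Pythagoras, Fubini and two anisotropic Gaussians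
  have hleft : ∫ w, gauss w ∂(μ₀.map ιC) =
      (2 * π) ^ ((finrank ℝ E : ℝ) / 2) / Real.sqrt dT * ((2 * π) ^ ((finrank ℝ F : ℝ) / 2) / Real.sqrt dU) := by
    rw [integral_map ιC.continuous.measurable.aemeasurable hgc.aestronglyMeasurable]
    have hsplit : ∀ z : E × F, gauss (ιC z) =
        Real.exp (-(1 / 2) * ⟪(LinearMap.adjoint T ∘ₗ T) z.1, z.1⟫_ℝ) *
          Real.exp (-(1 / 2) * ⟪(LinearMap.adjoint U ∘ₗ U) z.2, z.2⟫_ℝ) := by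
      intro z
      rw [hιCapply, hι, hgauss]
      simp only
      rw [norm_sq_add_eq_of_orthogonal horth, inner_adjoint_comp_self_apply,
        inner_adjoint_comp_self_apply, ← Real.exp_add]
      ring_nf
    simp_rw [hsplit]
    rw [hμ₀, integral_prod_mul (μ := (volume : Measure E)) (ν := (volume : Measure F))
      (fun φ : E => Real.exp (-(1 / 2) * ⟪(LinearMap.adjoint T ∘ₗ T) φ, φ⟫_ℝ))
      (fun y : F => Real.exp (-(1 / 2) * ⟪(LinearMap.adjoint U ∘ₗ U) y, y⟫_ℝ)),
      integral_exp_neg_half_inner_self' (isSymmetric_adjoint_comp_self T) (inner_adjoint_comp_self_pos hT),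
      integral_exp_neg_half_inner_self' (isSymmetric_adjoint_comp_self U) (inner_adjoint_comp_self_pos hU)]
  -- right side: a multiple of the standard Gaussian
  have hright : ∫ w, gauss w ∂(μ₀.map ιC) = (c : ℝ) * (2 * π) ^ ((finrank ℝ G : ℝ) / 2) := by
    rw [hm, integral_smul_nnreal_measure, integral_exp_neg_half_norm_sq, NNReal.smul_def, smul_eq_mul]
  -- dimension count: the standard Gaussian of `G` is the product of those of `E` and `F`
  have hdim : (2 * π : ℝ) ^ ((finrank ℝ G : ℝ) / 2) =
      (2 * π) ^ ((finrank ℝ E : ℝ) / 2) * (2 * π) ^ ((finrank ℝ F : ℝ) / 2) := by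
    rw [finrank_eq_add_of_orthogonal hT hU horth htop, Nat.cast_add, add_div,
      Real.rpow_add (by positivity : (0 : ℝ) < 2 * π)]
  -- solve for `c`
  have hcval : (c : ℝ) = (Real.sqrt dT * Real.sqrt dU)⁻¹ := by
    have h := hright.symm.trans hleft
    rw [hdim] at h
    field_simp at h
    field_simp
    nlinarith [h, hPE, hPF, Real.sqrt_pos.2 hdTpos, Real.sqrt_pos.2 hdUpos]
  -- conclude
  have hcE : ((c : ℝ≥0) : ℝ≥0∞) = (ENNReal.ofReal (Real.sqrt dT * Real.sqrt dU))⁻¹ := by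
    rw [← ENNReal.ofReal_coe_nnreal, hcval, ENNReal.ofReal_inv_of_pos hD]
  rw [hιfun, hm, ENNReal.smul_def, hcE]

/-- ★ **Lebesgue measure as a multiple of the pushed-forward product measure**: `dw = D · ι_*(dφ ⊗ dy)`,
`D = √det(T†T) · √det(U†U)`. [cite: EvansGariepy2015, §3.3.1 Lemma 3.1 (PDF p. 74)]
[cite: Breitung1994, Lemma 3 (2.2) (PDF p. 14)] -/
theorem volume_eq_smul_map_prod_volume (hT : Function.Injective T) (hU : Function.Injective U)
    (horth : ∀ φ y, ⟪T φ, U y⟫_ℝ = 0) (htop : LinearMap.range T ⊔ LinearMap.range U = ⊤)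
    (hι : ∀ z : E × F, ι z = T z.1 + U z.2) :
    (volume : Measure G) =
      ENNReal.ofReal (Real.sqrt (LinearMap.det (LinearMap.adjoint T ∘ₗ T)) *
        Real.sqrt (LinearMap.det (LinearMap.adjoint U ∘ₗ U))) •
        ((volume : Measure E).prod (volume : Measure F)).map ι := by
  have hD : 0 < Real.sqrt (LinearMap.det (LinearMap.adjoint T ∘ₗ T)) *
      Real.sqrt (LinearMap.det (LinearMap.adjoint U ∘ₗ U)) :=
    mul_pos (Real.sqrt_pos.2 (det_adjoint_comp_self_pos hT)) (Real.sqrt_pos.2 (det_adjoint_comp_self_pos hU))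
  rw [map_prod_volume_eq_inv_smul_volume hT hU horth htop hι, smul_smul,
    ENNReal.mul_inv_cancel (ENNReal.ofReal_pos.2 hD).ne' ENNReal.ofReal_ne_top, one_smul]

omit [FiniteDimensional ℝ G] in
/-- The orthogonal sum map, as a function, is a measurable embedding (a linear homeomorphism).
[cite: EvansGariepy2015, §3.3.1 Lemma 3.1 (PDF p. 74)] -/
theorem measurableEmbedding_of_orthogonal (hT : Function.Injective T) (hU : Function.Injective U)
    (horth : ∀ φ y, ⟪T φ, U y⟫_ℝ = 0) (htop : LinearMap.range T ⊔ LinearMap.range U = ⊤)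
    (hι : ∀ z : E × F, ι z = T z.1 + U z.2) : MeasurableEmbedding ι := by
  set ιE : (E × F) ≃ₗ[ℝ] G :=
    LinearEquiv.ofBijective (T.coprod U) (coprod_bijective_of_orthogonal hT hU horth htop) with hιE
  have hιfun : ι = ⇑(ιE.toContinuousLinearEquiv) := by
    funext z
    rw [hι z]
    simp [hιE, LinearMap.coprod_apply]
  rw [hιfun]
  exact ιE.toContinuousLinearEquiv.toHomeomorph.measurableEmbedding

/-- ★ **Substitution rule, `[0, ∞]`-valued**: `∫_G g dw = D · ∫_{E×F} g(Tφ + Uy) dφ dy` for measurable `g`.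
[cite: EvansGariepy2015, §3.3.1 Lemma 3.1 and §3.3.3 (change of variables) (PDF pp. 74, 78)] -/
theorem lintegral_volume_eq_mul_lintegral_prod (hT : Function.Injective T) (hU : Function.Injective U)
    (horth : ∀ φ y, ⟪T φ, U y⟫_ℝ = 0) (htop : LinearMap.range T ⊔ LinearMap.range U = ⊤)
    (hι : ∀ z : E × F, ι z = T z.1 + U z.2) (g : G → ℝ≥0∞) :
    ∫⁻ w, g w ∂(volume : Measure G) =
      ENNReal.ofReal (Real.sqrt (LinearMap.det (LinearMap.adjoint T ∘ₗ T)) *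
          Real.sqrt (LinearMap.det (LinearMap.adjoint U ∘ₗ U))) *
        ∫⁻ z, g (ι z) ∂((volume : Measure E).prod (volume : Measure F)) := by
  conv_lhs => rw [volume_eq_smul_map_prod_volume hT hU horth htop hι]
  rw [lintegral_smul_measure, (measurableEmbedding_of_orthogonal hT hU horth htop hι).lintegral_map,
    smul_eq_mul]

/-- ★ **Substitution rule, Bochner**: `∫_G g dw = D · ∫_{E×F} g(Tφ + Uy) dφ dy` for every `g : G → ℝ`.
[cite: EvansGariepy2015, §3.3.3 Thm 3.9 (change of variables) (PDF p. 78)] -/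
theorem integral_volume_eq_mul_integral_prod (hT : Function.Injective T) (hU : Function.Injective U)
    (horth : ∀ φ y, ⟪T φ, U y⟫_ℝ = 0) (htop : LinearMap.range T ⊔ LinearMap.range U = ⊤)
    (hι : ∀ z : E × F, ι z = T z.1 + U z.2) (g : G → ℝ) :
    ∫ w, g w ∂(volume : Measure G) =
      (Real.sqrt (LinearMap.det (LinearMap.adjoint T ∘ₗ T)) *
          Real.sqrt (LinearMap.det (LinearMap.adjoint U ∘ₗ U))) *
        ∫ z, g (ι z) ∂((volume : Measure E).prod (volume : Measure F)) := by
  have hD : 0 ≤ Real.sqrt (LinearMap.det (LinearMap.adjoint T ∘ₗ T)) *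
      Real.sqrt (LinearMap.det (LinearMap.adjoint U ∘ₗ U)) :=
    mul_nonneg (Real.sqrt_nonneg _) (Real.sqrt_nonneg _)
  conv_lhs => rw [volume_eq_smul_map_prod_volume hT hU horth htop hι]
  rw [integral_smul_measure, (measurableEmbedding_of_orthogonal hT hU horth htop hι).integral_map,
    ENNReal.toReal_ofReal hD, smul_eq_mul]

/-- ★ **Chart-identity format** (as consumed by `OrbitTubeMeasure.restrict_tube_eq_map_withDensity` and
`LaplaceMethodChart.tendsto_laplaceMethod_chart`): for measurable `Ω ⊆ E × F`,
`dw|_{ι(Ω)} = ι_*((dφ ⊗ dy)|_Ω · D)` with the constant density `D = √det(T†T) · √det(U†U)`.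
[cite: EvansGariepy2015, §3.3.1 Lemma 3.1 (PDF p. 74)] [cite: Breitung1994, Lemma 3 (2.2) (PDF p. 14)] -/
theorem volume_restrict_image_eq_map_withDensity (hT : Function.Injective T) (hU : Function.Injective U)
    (horth : ∀ φ y, ⟪T φ, U y⟫_ℝ = 0) (htop : LinearMap.range T ⊔ LinearMap.range U = ⊤)
    (hι : ∀ z : E × F, ι z = T z.1 + U z.2) {Ω : Set (E × F)} (hΩ : MeasurableSet Ω) :
    (volume : Measure G).restrict (ι '' Ω) =
      ((((volume : Measure E).prod (volume : Measure F)).restrict Ω).withDensity fun _ =>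
        ENNReal.ofReal (Real.sqrt (LinearMap.det (LinearMap.adjoint T ∘ₗ T)) *
          Real.sqrt (LinearMap.det (LinearMap.adjoint U ∘ₗ U)))).map ι := by
  have hemb := measurableEmbedding_of_orthogonal hT hU horth htop hι
  conv_lhs => rw [volume_eq_smul_map_prod_volume hT hU horth htop hι]
  rw [Measure.restrict_smul, Measure.restrict_map hemb.measurable (hemb.measurableSet_image.2 hΩ),
    Set.preimage_image_eq Ω hemb.injective, withDensity_const, Measure.map_smul]

/-! ### The isometric case (`U†U = 1`): `D = √det(T†T)` -/

/-- ★ **Orthogonal sum with an isometric second summand** (e.g. the inclusion of the orthogonal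
complement `(range T)ᗮ`): `ι_*(dφ ⊗ dy) = (√det(T†T))⁻¹ · dw`.
[cite: EvansGariepy2015, §3.2 Def. 3.4 ∕ Thm 3.6 (i), §3.3.1 Lemma 3.1 (PDF pp. 72–74)] -/
theorem map_prod_volume_eq_inv_smul_volume_of_isometry (hT : Function.Injective T) (U : F →ₗᵢ[ℝ] G)
    (horth : ∀ φ y, ⟪T φ, U y⟫_ℝ = 0) (htop : LinearMap.range T ⊔ LinearMap.range U.toLinearMap = ⊤)
    (hι : ∀ z : E × F, ι z = T z.1 + U z.2) :
    ((volume : Measure E).prod (volume : Measure F)).map ι =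
      (ENNReal.ofReal (Real.sqrt (LinearMap.det (LinearMap.adjoint T ∘ₗ T))))⁻¹ • (volume : Measure G) := by
  have h := map_prod_volume_eq_inv_smul_volume (U := U.toLinearMap) hT U.injective horth htop hι
  rwa [adjoint_comp_self_of_isometry, LinearMap.det_id, Real.sqrt_one, mul_one] at h

/-- Chart-identity format in the isometric case: `dw|_{ι(Ω)} = ι_*((dφ ⊗ dy)|_Ω · √det(T†T))`.
[cite: EvansGariepy2015, §3.3.1 Lemma 3.1 (PDF p. 74)] [cite: Breitung1994, Lemma 3 (2.2) (PDF p. 14)] -/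
theorem volume_restrict_image_eq_map_withDensity_of_isometry (hT : Function.Injective T)
    (U : F →ₗᵢ[ℝ] G) (horth : ∀ φ y, ⟪T φ, U y⟫_ℝ = 0)
    (htop : LinearMap.range T ⊔ LinearMap.range U.toLinearMap = ⊤)
    (hι : ∀ z : E × F, ι z = T z.1 + U z.2) {Ω : Set (E × F)} (hΩ : MeasurableSet Ω) :
    (volume : Measure G).restrict (ι '' Ω) =
      ((((volume : Measure E).prod (volume : Measure F)).restrict Ω).withDensity fun _ =>
        ENNReal.ofReal (Real.sqrt (LinearMap.det (LinearMap.adjoint T ∘ₗ T)))).map ι := by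
  have h := volume_restrict_image_eq_map_withDensity (U := U.toLinearMap) hT U.injective horth htop hι hΩ
  rwa [adjoint_comp_self_of_isometry, LinearMap.det_id, Real.sqrt_one, mul_one] at h

end Measure

end Literature.Analysis.InnerProduct
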